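import Literature.NumberTheory.Sieve.FordMaynardPolyhedral
import Mathlib.Topology.MetricSpace.Lipschitz
import HarnessLib

/-!
# The piecewise-Lipschitz calculus (Ford–Maynard, Definition 6.2 (b))

Two classes of real functions on a finite-dimensional real normed space `E`, and their closure
properties; everything here is PROVED.

* `PolyLip F` — `F = ∑ₜ 𝟙_{Qₜ} · Lₜ`, a finite sum, with `Qₜ` POLYHEDRAL (possibly unbounded,
  `IsPolyhedral`) and `Lₜ` Lipschitz and bounded on `Qₜ`. Closed under sums, products, finite `∑`/`∏`,
  multiplication by indicators of polyhedral sets, and composition with linear maps. This is the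
  shape of the integrand of the fragmentation relation (6.3)/(fsl) as a function of all variables.
* `IsPiecewiseLipschitz' g` — `g = ∑ᵢ hᵢ` with `hᵢ` supported on a BOUNDED polyhedral set `Pᵢ` and
  Lipschitz on it: Definition 6.2 (b) with polytopes in the coordinate-free form; for `E = ℝ^k` it is
  equivalent to `IsPiecewiseLipschitz` (`IsPiecewiseLipschitz'.isPiecewiseLipschitz`,
  `IsPiecewiseLipschitz.isPiecewiseLipschitz'`), and it implies `PolyLip` and bounded support.
  Closed under finite sums and under multiplication by functions Lipschitz and bounded on bounded sets.
* `lipschitzOnWith_mul_of_bounded` — products of bounded Lipschitz functions are Lipschitz.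

## References

* K. Ford, J. Maynard, *On the theory of prime producing sieves*, arXiv:2407.14368v1 (2024), §6
  Definition 6.2 (b); §6.2 and §9 (functions defined by (fsl) are treated as members of `𝔉_η`).
  [FordMaynard2024PrimeSieves]
-/

noncomputable section

open Set

namespace Literature.NumberTheory.Sieve.FordMaynard

/-! ### Bounded Lipschitz functions -/

/-- The product of two bounded Lipschitz real functions on a set is Lipschitz on it. [folklore] -/
theorem lipschitzOnWith_mul_of_bounded {X : Type*} [PseudoMetricSpace X] {f g : X → ℝ}
    {Kf Kg : NNReal} {s : Set X} {Mf Mg : ℝ} (hf : LipschitzOnWith Kf f s)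
    (hg : LipschitzOnWith Kg g s) (hMf : ∀ x ∈ s, |f x| ≤ Mf) (hMg : ∀ x ∈ s, |g x| ≤ Mg) :
    LipschitzOnWith (Real.toNNReal (Mf * Kg + Mg * Kf)) (fun x => f x * g x) s := by
  refine LipschitzOnWith.of_dist_le' fun x hx y hy => ?_
  have h1 := hf.dist_le_mul x hx y hy
  have h2 := hg.dist_le_mul x hx y hy
  rw [Real.dist_eq] at h1 h2 ⊢
  have : f x * g x - f y * g y = f x * (g x - g y) + g y * (f x - f y) := by ring
  rw [this]
  calc |f x * (g x - g y) + g y * (f x - f y)|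
      ≤ |f x| * |g x - g y| + |g y| * |f x - f y| := by
        refine (abs_add_le _ _).trans ?_
        rw [abs_mul, abs_mul]
    _ ≤ Mf * (Kg * dist x y) + Mg * (Kf * dist x y) :=
        add_le_add (mul_le_mul (hMf x hx) h2 (abs_nonneg _) ((abs_nonneg _).trans (hMf x hx)))
          (mul_le_mul (hMg y hy) h1 (abs_nonneg _) ((abs_nonneg _).trans (hMg y hy)))
    _ = (Mf * Kg + Mg * Kf) * dist x y := by ring

/-- A finite product of bounded Lipschitz real functions on a set is Lipschitz and bounded on it.
[folklore] -/
theorem lipschitzOnWith_prod_of_bounded {X : Type*} [PseudoMetricSpace X] {κ : Type*}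
    (t : Finset κ) {f : κ → X → ℝ} {s : Set X}
    (hf : ∀ k ∈ t, (∃ K, LipschitzOnWith K (f k) s) ∧ ∃ M, ∀ x ∈ s, |f k x| ≤ M) :
    (∃ K, LipschitzOnWith K (fun x => ∏ k ∈ t, f k x) s) ∧
      ∃ M, ∀ x ∈ s, |∏ k ∈ t, f k x| ≤ M := by
  classical
  induction t using Finset.induction_on with
  | empty =>
    refine ⟨⟨0, ?_⟩, ⟨1, fun x _ => by simp⟩⟩
    simp only [Finset.prod_empty]
    exact (LipschitzWith.const (1 : ℝ)).lipschitzOnWith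
  | insert a t ha ih =>
    obtain ⟨⟨K, hK⟩, ⟨M, hM⟩⟩ := ih fun k hk => hf k (Finset.mem_insert_of_mem hk)
    obtain ⟨⟨Ka, hKa⟩, ⟨Ma, hMa⟩⟩ := hf a (Finset.mem_insert_self a t)
    refine ⟨⟨Real.toNNReal (Ma * K + M * Ka), ?_⟩, ⟨Ma * M, fun x hx => ?_⟩⟩
    · have := lipschitzOnWith_mul_of_bounded hKa hK hMa hM
      simpa only [Finset.prod_insert ha] using this
    · rw [Finset.prod_insert ha, abs_mul]
      exact mul_le_mul (hMa x hx) (hM x hx) (abs_nonneg _) ((abs_nonneg _).trans (hMa x hx))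

/-- A Lipschitz function on a bounded set is bounded there. [folklore] -/
theorem exists_abs_le_of_lipschitzOnWith {X : Type*} [PseudoMetricSpace X] {f : X → ℝ} {K : NNReal}
    {s : Set X} (hf : LipschitzOnWith K f s) (hs : Bornology.IsBounded s) :
    ∃ M, ∀ x ∈ s, |f x| ≤ M := by
  rcases s.eq_empty_or_nonempty with rfl | ⟨x₀, hx₀⟩
  · exact ⟨0, fun x hx => hx.elim⟩
  obtain ⟨r, hr⟩ := hs.subset_closedBall x₀
  refine ⟨|f x₀| + K * r, fun x hx => ?_⟩
  have h1 := hf.dist_le_mul x hx x₀ hx₀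
  rw [Real.dist_eq] at h1
  have h2 : dist x x₀ ≤ r := hr hx
  calc |f x| = |f x₀ + (f x - f x₀)| := by ring_nf
    _ ≤ |f x₀| + |f x - f x₀| := abs_add_le _ _
    _ ≤ |f x₀| + K * r := by
        refine add_le_add le_rfl (h1.trans ?_)
        exact mul_le_mul_of_nonneg_left h2 K.2

section PolyLip

variable {E : Type*} [NormedAddCommGroup E] [NormedSpace ℝ E]

/-! ### The class `PolyLip` -/

/-- **`PolyLip F`**: `F : E → ℝ` is a finite sum `∑ₜ 𝟙_{Qₜ} Lₜ` of functions `Lₜ` that are Lipschitz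
and bounded on a polyhedral set `Qₜ` (`IsPolyhedral`, possibly unbounded), cut off outside `Qₜ`.
[cite: FordMaynard2024PrimeSieves, Definition 6.2 (b)] -/
def PolyLip (F : E → ℝ) : Prop :=
  ∃ (ι : Type) (_ : Fintype ι) (Q : ι → Set E) (L : ι → E → ℝ),
    (∀ t, IsPolyhedral (Q t) ∧ (∃ K, LipschitzOnWith K (L t) (Q t)) ∧ ∃ M, ∀ x ∈ Q t, |L t x| ≤ M) ∧
    ∀ x, F x = ∑ t, (Q t).indicator (L t) x

/-- A single cut-off bounded Lipschitz function on a polyhedral set is in `PolyLip`. [folklore] -/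
theorem PolyLip.of_indicator {Q : Set E} {L : E → ℝ} (hQ : IsPolyhedral Q) {K : NNReal}
    (hK : LipschitzOnWith K L Q) {M : ℝ} (hM : ∀ x ∈ Q, |L x| ≤ M) : PolyLip (Q.indicator L) :=
  ⟨Unit, inferInstance, fun _ => Q, fun _ => L, fun _ => ⟨hQ, ⟨K, hK⟩, ⟨M, hM⟩⟩, fun x => by simp⟩

/-- Constants are in `PolyLip`. [folklore] -/
theorem PolyLip.const (c : ℝ) : PolyLip (fun _ : E => c) := by
  have h := PolyLip.of_indicator (isPolyhedral_univ (E := E)) (K := 0) (L := fun _ => c)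
    ((LipschitzWith.const c).lipschitzOnWith) (M := |c|) (fun _ _ => le_rfl)
  simpa using h

/-- The indicator of a polyhedral set is in `PolyLip`. [folklore] -/
theorem PolyLip.indicator_one {Q : Set E} (hQ : IsPolyhedral Q) :
    PolyLip (Q.indicator fun _ => (1 : ℝ)) :=
  PolyLip.of_indicator hQ (K := 0) ((LipschitzWith.const (1 : ℝ)).lipschitzOnWith) (M := 1)
    (fun _ _ => by simp)

/-- `PolyLip` is closed under addition. [folklore] -/
theorem PolyLip.add {F G : E → ℝ} (hF : PolyLip F) (hG : PolyLip G) :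
    PolyLip (fun x => F x + G x) := by
  obtain ⟨ι, hι, Q, L, hQ, hF⟩ := hF
  obtain ⟨ι', hι', Q', L', hQ', hG⟩ := hG
  refine ⟨ι ⊕ ι', inferInstance, Sum.elim Q Q', Sum.elim L L', ?_, fun x => ?_⟩
  · rintro (t | t)
    · exact hQ t
    · exact hQ' t
  · show F x + G x = _
    rw [Fintype.sum_sum_type, hF x, hG x]
    simp

/-- `PolyLip` is closed under finite sums. [folklore] -/
theorem PolyLip.finset_sum {κ : Type*} (s : Finset κ) {F : κ → E → ℝ}
    (h : ∀ k ∈ s, PolyLip (F k)) : PolyLip (fun x => ∑ k ∈ s, F k x) := by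
  classical
  induction s using Finset.induction_on with
  | empty => simpa using PolyLip.const (E := E) 0
  | insert a s ha ih =>
    have := (h a (Finset.mem_insert_self a s)).add (ih fun k hk => h k (Finset.mem_insert_of_mem hk))
    simpa only [Finset.sum_insert ha] using this

/-- `PolyLip` is closed under multiplication (pieces `Qₜ ∩ Q'ₜ'`, bounded Lipschitz products).
[folklore] -/
theorem PolyLip.mul {F G : E → ℝ} (hF : PolyLip F) (hG : PolyLip G) :
    PolyLip (fun x => F x * G x) := by
  obtain ⟨ι, hι, Q, L, hQ, hF⟩ := hF
  obtain ⟨ι', hι', Q', L', hQ', hG⟩ := hG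
  refine ⟨ι × ι', inferInstance, fun p => Q p.1 ∩ Q' p.2, fun p x => L p.1 x * L' p.2 x,
    fun p => ⟨(hQ p.1).1.inter (hQ' p.2).1, ?_, ?_⟩, fun x => ?_⟩
  · obtain ⟨K, hK⟩ := (hQ p.1).2.1
    obtain ⟨M, hM⟩ := (hQ p.1).2.2
    obtain ⟨K', hK'⟩ := (hQ' p.2).2.1
    obtain ⟨M', hM'⟩ := (hQ' p.2).2.2
    exact ⟨_, lipschitzOnWith_mul_of_bounded (hK.mono inter_subset_left)
      (hK'.mono inter_subset_right) (fun x hx => hM x hx.1) (fun x hx => hM' x hx.2)⟩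
  · obtain ⟨M, hM⟩ := (hQ p.1).2.2
    obtain ⟨M', hM'⟩ := (hQ' p.2).2.2
    refine ⟨M * M', fun x hx => ?_⟩
    rw [abs_mul]
    exact mul_le_mul (hM x hx.1) (hM' x hx.2) (abs_nonneg _) ((abs_nonneg _).trans (hM x hx.1))
  · show F x * G x = ∑ p : ι × ι', (Q p.1 ∩ Q' p.2).indicator (fun x => L p.1 x * L' p.2 x) x
    rw [hF x, hG x, Finset.sum_mul_sum, Fintype.sum_prod_type]
    refine Finset.sum_congr rfl fun t _ => Finset.sum_congr rfl fun t' _ => ?_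
    exact (Set.inter_indicator_mul (L t) (L' t') x).symm

/-- `PolyLip` is closed under finite products. [folklore] -/
theorem PolyLip.finset_prod {κ : Type*} (s : Finset κ) {F : κ → E → ℝ}
    (h : ∀ k ∈ s, PolyLip (F k)) : PolyLip (fun x => ∏ k ∈ s, F k x) := by
  classical
  induction s using Finset.induction_on with
  | empty => simpa using PolyLip.const (E := E) 1
  | insert a s ha ih =>
    have := (h a (Finset.mem_insert_self a s)).mul (ih fun k hk => h k (Finset.mem_insert_of_mem hk))
    simpa only [Finset.prod_insert ha] using this

/-- `PolyLip` is closed under multiplication by the indicator of a polyhedral set. [folklore] -/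
theorem PolyLip.indicator {F : E → ℝ} (hF : PolyLip F) {S : Set E} (hS : IsPolyhedral S) :
    PolyLip (S.indicator F) := by
  have h := (PolyLip.indicator_one hS).mul hF
  convert h using 1
  funext x
  by_cases hx : x ∈ S
  · simp [Set.indicator_of_mem hx]
  · simp [Set.indicator_of_notMem hx]

/-- `PolyLip` is closed under scalar multiplication. [folklore] -/
theorem PolyLip.const_mul {F : E → ℝ} (hF : PolyLip F) (c : ℝ) : PolyLip (fun x => c * F x) :=
  (PolyLip.const c).mul hF

/-- `PolyLip` is closed under composition with linear maps from a finite-dimensional space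
(preimages of polyhedral sets are polyhedral; linear maps are Lipschitz). [folklore] -/
theorem PolyLip.comp {E' : Type*} [NormedAddCommGroup E'] [NormedSpace ℝ E']
    [FiniteDimensional ℝ E'] {F : E → ℝ} (hF : PolyLip F) (A : E' →ₗ[ℝ] E) :
    PolyLip (fun x => F (A x)) := by
  obtain ⟨ι, hι, Q, L, hQ, hF⟩ := hF
  have hA : LipschitzWith ‖LinearMap.toContinuousLinearMap A‖₊ A := by
    have := (LinearMap.toContinuousLinearMap A).lipschitz
    rwa [LinearMap.coe_toContinuousLinearMap'] at this
  refine ⟨ι, hι, fun t => A ⁻¹' Q t, fun t x => L t (A x), fun t => ⟨(hQ t).1.preimage A, ?_, ?_⟩,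
    fun x => ?_⟩
  · obtain ⟨K, hK⟩ := (hQ t).2.1
    exact ⟨_, hK.comp (hA.lipschitzOnWith) (Set.mapsTo_preimage A (Q t))⟩
  · obtain ⟨M, hM⟩ := (hQ t).2.2
    exact ⟨M, fun x hx => hM (A x) hx⟩
  · show F (A x) = ∑ t, (A ⁻¹' Q t).indicator (fun x => L t (A x)) x
    rw [hF (A x)]
    refine Finset.sum_congr rfl fun t _ => ?_
    exact (Set.indicator_comp_right (f := A) (s := Q t) (g := L t) (x := x)).symm

/-- If `F` and `G` agree everywhere, `PolyLip` transfers. [folklore] -/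
theorem PolyLip.congr {F G : E → ℝ} (hF : PolyLip F) (h : ∀ x, F x = G x) : PolyLip G := by
  have : F = G := funext h
  rwa [this] at hF

/-! ### Piecewise Lipschitz functions on bounded polyhedral pieces -/

/-- **Definition 6.2 (b), coordinate-free form**: `g = ∑ᵢ hᵢ`, a finite sum, with `hᵢ` supported on
a bounded polyhedral set `Pᵢ` and Lipschitz on `Pᵢ`. [cite: FordMaynard2024PrimeSieves, Definition 6.2 (b)] -/
def IsPiecewiseLipschitz' (g : E → ℝ) : Prop :=
  ∃ (ι : Type) (_ : Fintype ι) (P : ι → Set E) (h : ι → E → ℝ),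
    (∀ i, IsPolyhedral (P i) ∧ Bornology.IsBounded (P i) ∧ (∀ x, x ∉ P i → h i x = 0) ∧
      ∃ K, LipschitzOnWith K (h i) (P i)) ∧
    ∀ x, g x = ∑ i, h i x

/-- The zero function is piecewise Lipschitz. [folklore] -/
theorem IsPiecewiseLipschitz'.zero : IsPiecewiseLipschitz' (fun _ : E => (0 : ℝ)) :=
  ⟨Empty, inferInstance, Empty.elim, Empty.elim, fun i => i.elim, fun x => by simp⟩

/-- Sums of piecewise Lipschitz functions are piecewise Lipschitz. [folklore] -/
theorem IsPiecewiseLipschitz'.add {g g' : E → ℝ} (hg : IsPiecewiseLipschitz' g)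
    (hg' : IsPiecewiseLipschitz' g') : IsPiecewiseLipschitz' (fun x => g x + g' x) := by
  obtain ⟨ι, hι, P, h, hP, hg⟩ := hg
  obtain ⟨ι', hι', P', h', hP', hg'⟩ := hg'
  refine ⟨ι ⊕ ι', inferInstance, Sum.elim P P', Sum.elim h h', ?_, fun x => ?_⟩
  · rintro (i | i)
    · exact hP i
    · exact hP' i
  · show g x + g' x = _
    rw [Fintype.sum_sum_type, hg x, hg' x]
    simp

/-- Finite sums of piecewise Lipschitz functions are piecewise Lipschitz. [folklore] -/
theorem IsPiecewiseLipschitz'.finset_sum {κ : Type*} (s : Finset κ) {g : κ → E → ℝ}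
    (h : ∀ k ∈ s, IsPiecewiseLipschitz' (g k)) :
    IsPiecewiseLipschitz' (fun x => ∑ k ∈ s, g k x) := by
  classical
  induction s using Finset.induction_on with
  | empty => simpa using IsPiecewiseLipschitz'.zero (E := E)
  | insert a s ha ih =>
    have := (h a (Finset.mem_insert_self a s)).add (ih fun k hk => h k (Finset.mem_insert_of_mem hk))
    simpa only [Finset.sum_insert ha] using this

/-- Multiplying a piecewise Lipschitz function by a function that is Lipschitz and bounded on every
bounded set keeps it piecewise Lipschitz (same pieces). [folklore] -/
theorem IsPiecewiseLipschitz'.mul_left {g : E → ℝ} (hg : IsPiecewiseLipschitz' g) (q : E → ℝ)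
    (hq : ∀ S : Set E, Bornology.IsBounded S →
      (∃ K, LipschitzOnWith K q S) ∧ ∃ M, ∀ x ∈ S, |q x| ≤ M) :
    IsPiecewiseLipschitz' (fun x => q x * g x) := by
  obtain ⟨ι, hι, P, h, hP, hg⟩ := hg
  refine ⟨ι, hι, P, fun i x => q x * h i x, fun i => ⟨(hP i).1, (hP i).2.1, fun x hx => ?_, ?_⟩,
    fun x => ?_⟩
  · show q x * h i x = 0
    rw [(hP i).2.2.1 x hx, mul_zero]
  · obtain ⟨⟨K, hK⟩, ⟨M, hM⟩⟩ := hq (P i) (hP i).2.1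
    obtain ⟨K', hK'⟩ := (hP i).2.2.2
    obtain ⟨M', hM'⟩ := exists_abs_le_of_lipschitzOnWith hK' (hP i).2.1
    exact ⟨_, lipschitzOnWith_mul_of_bounded hK hK' hM hM'⟩
  · show q x * g x = ∑ i, q x * h i x
    rw [hg x, Finset.mul_sum]

/-- A piecewise Lipschitz function is in `PolyLip` (its pieces are bounded, so the Lipschitz
summands are bounded on them). [folklore] -/
theorem IsPiecewiseLipschitz'.polyLip {g : E → ℝ} (hg : IsPiecewiseLipschitz' g) : PolyLip g := by
  obtain ⟨ι, hι, P, h, hP, hg⟩ := hg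
  refine ⟨ι, hι, P, h, fun i => ⟨(hP i).1, (hP i).2.2.2, ?_⟩, fun x => ?_⟩
  · obtain ⟨K, hK⟩ := (hP i).2.2.2
    exact exists_abs_le_of_lipschitzOnWith hK (hP i).2.1
  · rw [hg x]
    refine Finset.sum_congr rfl fun i _ => ?_
    by_cases hx : x ∈ P i
    · rw [Set.indicator_of_mem hx]
    · rw [Set.indicator_of_notMem hx, (hP i).2.2.1 x hx]

/-- A piecewise Lipschitz function has bounded support. [folklore] -/
theorem IsPiecewiseLipschitz'.exists_isBounded {g : E → ℝ} (hg : IsPiecewiseLipschitz' g) :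
    ∃ S : Set E, Bornology.IsBounded S ∧ ∀ x, g x ≠ 0 → x ∈ S := by
  obtain ⟨ι, hι, P, h, hP, hg⟩ := hg
  refine ⟨⋃ i, P i, Bornology.isBounded_iUnion.2 fun i => (hP i).2.1, fun x hx => ?_⟩
  rw [hg x] at hx
  obtain ⟨i, -, hi⟩ := Finset.exists_ne_zero_of_sum_ne_zero hx
  exact Set.mem_iUnion.2 ⟨i, by_contra fun hxi => hi ((hP i).2.2.1 x hxi)⟩

end PolyLip

/-! ### Back and forth with the coordinate form on `ℝ^k` -/

section Coordinates

variable {k : ℕ}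

/-- Definition 6.2 (b) in coordinates implies the coordinate-free form. [cite: FordMaynard2024PrimeSieves, Definition 6.2 (b)] -/
theorem IsPiecewiseLipschitz.isPiecewiseLipschitz' {g : (Fin k → ℝ) → ℝ} (hg : IsPiecewiseLipschitz g) :
    IsPiecewiseLipschitz' g := by
  obtain ⟨m, P, h, hP, hg⟩ := hg
  exact ⟨Fin m, inferInstance, P, h,
    fun j => ⟨(hP j).1.isPolyhedral, (hP j).1.1, (hP j).2.1, (hP j).2.2⟩, hg⟩

/-- The coordinate-free form implies Definition 6.2 (b) in coordinates. [cite: FordMaynard2024PrimeSieves, Definition 6.2 (b)] -/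
theorem IsPiecewiseLipschitz'.isPiecewiseLipschitz {g : (Fin k → ℝ) → ℝ} (hg : IsPiecewiseLipschitz' g) :
    IsPiecewiseLipschitz g := by
  classical
  obtain ⟨ι, hι, P, h, hP, hg⟩ := hg
  refine ⟨Fintype.card ι, fun j => P ((Fintype.equivFin ι).symm j),
    fun j => h ((Fintype.equivFin ι).symm j), fun j => ⟨?_, (hP _).2.2.1, (hP _).2.2.2⟩, fun x => ?_⟩
  · exact (hP _).1.isConvexPolytope (hP _).2.1
  · rw [hg x]
    exact (Equiv.sum_comp (Fintype.equivFin ι).symm (fun j => h j x)).symm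

/-- A piecewise Lipschitz function on `ℝ^k` vanishes outside a coordinate box. [folklore] -/
theorem IsPiecewiseLipschitz.exists_abs_le {g : (Fin k → ℝ) → ℝ} (hg : IsPiecewiseLipschitz g) :
    ∃ R : ℝ, 0 ≤ R ∧ ∀ x, g x ≠ 0 → ∀ i, |x i| ≤ R := by
  obtain ⟨S, hS, hgS⟩ := hg.isPiecewiseLipschitz'.exists_isBounded
  obtain ⟨R, hR, hRS⟩ := exists_abs_le_of_isBounded hS
  exact ⟨R, hR, fun x hx => hRS x (hgS x hx)⟩

end Coordinates

end Literature.NumberTheory.Sieve.FordMaynard
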